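import Mathlib
import Summits.AtomisticToContinuum.Crystallization.Theorems.NashClassCertificatesNashNearFieldStubTriLandscapeFarSemantics

/-!
# Crux `NashNearField` (16827), stub `stub_triLandscapeFar`: the certified-numerics kernel III —
# interval helpers, vector enclosures, the algebra of quadratic forms, row-level inclusion theorems

Theorems about the data of `…FarKernel` / `…FarSemantics`: inclusion lemmas for the added interval operations
(`fiOfRat`, `fiScale`, `fiSqr`, `fiPow`, …); the list-of-intervals enclosures (`getFI`/`addAt`/`zipWith`/`map`);
the exact algebra of quadratic forms of affine rows (`q(c + d) = q(c) + ∇q(c)·d + C(d)`,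
`q(c + d) − q(c) = ∇q(c + d/2)·d`, `C = ½ dᵀ∇²q d`, coordinate forms); and, on a box, `rowCentre ∋ ℓ_r(c)`,
`rowDev ≥ Σ|α_k| e_k`, `rowRange ∋ ℓ_r(t)`.
-/

noncomputable section

namespace Summit.AtomisticToContinuum.Crystallization.Theorems.NashClassCertificatesNashNearField

namespace Far

open Literature.Analysis.ValidatedNumerics.Numerics

/-! ### Interval helpers: inclusion lemmas -/

/-- [folklore] -/
theorem mem_fiZero : FI.mem 0 fiZero := by simp [FI.mem, fiZero]

/-- [folklore] -/
theorem mem_point (z : ℤ) : FI.mem ((z : ℝ) / SC) ⟨z, z⟩ := FI.mem_ofScaled z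

/-- [folklore] -/
theorem mem_fiOfRat (q : ℚ) : FI.mem (q : ℝ) (fiOfRat q) := by
  have h := FI.mem_ofFrac q.num q.den_pos
  rwa [show ((q.num : ℝ) / (q.den : ℕ)) = (q : ℝ) by rw [Rat.cast_def]] at h

/-- [folklore] -/
theorem mem_fiScale {x : ℝ} {I : FI} (hx : FI.mem x I) (q : ℚ) : FI.mem (x * q) (fiScale I q) := by
  have h := FI.mem_divNat (FI.mem_mulInt hx q.num) q.den_pos
  rw [fiScale]
  convert h using 1
  rw [Rat.cast_def]; ring

/-- [folklore] -/
theorem mem_fiScale' {x : ℝ} {I : FI} (hx : FI.mem x I) (q : ℚ) : FI.mem (q * x) (fiScale I q) := by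
  rw [mul_comm]; exact mem_fiScale hx q

/-- [folklore] -/
theorem mem_fiSqr {x : ℝ} {I : FI} (hx : FI.mem x I) : FI.mem (x ^ 2) (fiSqr I) := by
  obtain ⟨h1, h2⟩ := hx
  have hS := SC_pos
  unfold fiSqr
  split_ifs with hlo hhi
  · have hlo' : (0 : ℝ) ≤ I.lo := by exact_mod_cast hlo
    have hxS : 0 ≤ x * SC := hlo'.trans h1
    refine ⟨?_, ?_⟩
    · have h := fdiv_mul_le_real (a := I.lo * I.lo) SCZ_pos
      push_cast at h
      nlinarith [mul_le_mul h1 h1 hlo' hxS]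
    · have h := le_cdiv_mul_real (a := I.hi * I.hi) SCZ_pos
      push_cast at h
      nlinarith [mul_le_mul h2 h2 hxS (hxS.trans h2)]
  · have hhi' : (I.hi : ℝ) ≤ 0 := by exact_mod_cast hhi
    have hxS : x * SC ≤ 0 := h2.trans hhi'
    refine ⟨?_, ?_⟩
    · have h := fdiv_mul_le_real (a := I.hi * I.hi) SCZ_pos
      push_cast at h
      nlinarith [mul_le_mul_of_nonpos_of_nonpos h2 h2 hxS hhi']
    · have h := le_cdiv_mul_real (a := I.lo * I.lo) SCZ_pos
      push_cast at h
      nlinarith [mul_le_mul_of_nonpos_of_nonpos h1 h1 (h1.trans hxS) hxS]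
  · push Not at hlo hhi
    refine ⟨by push_cast; positivity, ?_⟩
    have h := le_cdiv_mul_real (a := max (I.lo * I.lo) (I.hi * I.hi)) SCZ_pos
    push_cast at h
    have hsq : (x * SC) * (x * SC) ≤ max ((I.lo : ℝ) * I.lo) ((I.hi : ℝ) * I.hi) := by
      rcases le_total 0 (x * SC) with h0 | h0
      · exact (mul_le_mul h2 h2 h0 (h0.trans h2)).trans (le_max_right _ _)
      · exact (mul_le_mul_of_nonpos_of_nonpos h1 h1 (h1.trans h0) h0).trans (le_max_left _ _)
    nlinarith

/-- [folklore] -/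
theorem mem_fiPow {x : ℝ} {I : FI} (hx : FI.mem x I) : ∀ n : ℕ, FI.mem (x ^ n) (fiPow I n)
  | 0 => by simpa [fiPow] using FI.mem_ofInt 1
  | n + 1 => by rw [pow_succ]; exact FI.mem_mul (mem_fiPow hx n) hx

/-- [folklore] -/
theorem mem_fiLoPt (I : FI) : FI.mem ((I.lo : ℝ) / SC) (fiLoPt I) := mem_point I.lo

/-- [folklore] -/
theorem mem_fiHiPt (I : FI) : FI.mem ((I.hi : ℝ) / SC) (fiHiPt I) := mem_point I.hi

/-! ### Enclosure of real vectors by lists of intervals -/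

/-- [folklore] -/
theorem getFI_cons_zero (a : FI) (v : List FI) : getFI (a :: v) 0 = a := rfl

/-- [folklore] -/
theorem getFI_cons_succ (a : FI) (v : List FI) (k : ℕ) : getFI (a :: v) (k + 1) = getFI v k := rfl

/-- [folklore] -/
theorem getFI_of_le {v : List FI} {k : ℕ} (h : v.length ≤ k) : getFI v k = fiZero := by
  unfold getFI; rw [List.getD_eq_getElem?_getD, List.getElem?_eq_none h]; rfl

/-- A real enclosed by the zero interval vanishes. [folklore] -/
theorem eq_zero_of_mem_fiZero {x : ℝ} (h : FI.mem x fiZero) : x = 0 := by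
  simp only [FI.mem, fiZero, Int.cast_zero] at h
  have : x * SC = 0 := le_antisymm h.2 h.1
  rcases mul_eq_zero.1 this with h0 | h0
  · exact h0
  · exact absurd h0 SC_ne

/-- [folklore] -/
theorem vmem_zeros (n : ℕ) : VMem (zeros n) (fun _ => 0) := by
  intro k
  unfold getFI zeros
  rw [List.getD_eq_getElem?_getD, List.getElem?_replicate]
  split_ifs <;> exact mem_fiZero

/-- [folklore] -/
theorem length_addAt : ∀ (G : List FI) (k : ℕ) (X : FI), (addAt G k X).length = G.length
  | [], _, _ => rfl
  | _ :: _, 0, _ => rfl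
  | a :: v, k + 1, X => by simp [addAt, length_addAt v k X]

/-- [folklore] -/
theorem getFI_addAt : ∀ (G : List FI) (k : ℕ) (X : FI) (i : ℕ),
    getFI (addAt G k X) i = if i = k ∧ k < G.length then FI.add (getFI G i) X else getFI G i
  | [], k, X, i => by simp [addAt, getFI]
  | a :: v, 0, X, 0 => by simp [addAt, getFI]
  | a :: v, 0, X, i + 1 => by simp [addAt, getFI]
  | a :: v, k + 1, X, 0 => by simp [addAt, getFI]
  | a :: v, k + 1, X, i + 1 => by
      rw [addAt, getFI_cons_succ, getFI_addAt v k X i, getFI_cons_succ]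
      simp only [List.length_cons, Nat.add_lt_add_iff_right, Nat.add_right_cancel_iff]

/-- **Adding an enclosed real at an in-range slot.** [folklore] -/
theorem vmem_addAt {G : List FI} {g : ℕ → ℝ} (hG : VMem G g) {x : ℝ} {X : FI} (hx : FI.mem x X) {k : ℕ}
    (hk : k < G.length) : VMem (addAt G k X) (fun i => g i + if i = k then x else 0) := by
  intro i
  rw [getFI_addAt]
  by_cases hi : i = k
  · subst hi; simp only [hk, and_self, if_true]; exact FI.mem_add (hG i) hx
  · simp only [hi, false_and, if_false, add_zero]; exact hG i

/-! ### Real rows and terms -/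

namespace RRow

/-- [folklore] -/
theorem sum_map_mul_add (l : List (ℕ × ℝ)) (c d : ℕ → ℝ) :
    (l.map fun p => p.2 * (c p.1 + d p.1)).sum = (l.map fun p => p.2 * c p.1).sum + (l.map fun p => p.2 * d p.1).sum := by
  induction l with
  | nil => simp
  | cons p l ih => simp only [List.map_cons, List.sum_cons, ih]; ring

/-- [folklore] -/
theorem ell_add (R : RRow) (c d : ℕ → ℝ) : R.ell (fun k => c k + d k) = R.ell c + R.lam d := by
  unfold ell lam; rw [sum_map_mul_add]; ring

/-- [folklore] -/
theorem lam_smul (R : RRow) (a : ℝ) (d : ℕ → ℝ) : R.lam (fun k => a * d k) = a * R.lam d := by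
  unfold lam
  induction R.coef with
  | nil => simp
  | cons p l ih => simp only [List.map_cons, List.sum_cons] at ih ⊢; rw [ih]; ring

/-- [folklore] -/
theorem abs_lam_le (R : RRow) {d e : ℕ → ℝ} (hd : ∀ k, |d k| ≤ e k) : |R.lam d| ≤ R.dev e := by
  unfold lam dev
  induction R.coef with
  | nil => simp
  | cons p l ih =>
    simp only [List.map_cons, List.sum_cons]
    refine (abs_add_le _ _).trans (add_le_add ?_ ih)
    rw [abs_mul]; exact mul_le_mul_of_nonneg_left (hd p.1) (abs_nonneg _)

/-- [folklore] -/
theorem sum_map_eq_sum_range (l : List (ℕ × ℝ)) (h6 : ∀ p ∈ l, p.1 < 6) (d : ℕ → ℝ) :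
    (l.map fun p => p.2 * d p.1).sum = ∑ k ∈ Finset.range 6, (l.map fun p => if p.1 = k then p.2 else 0).sum * d k := by
  induction l with
  | nil => simp
  | cons p l ih =>
    simp only [List.map_cons, List.sum_cons]
    rw [ih (fun q hq => h6 q (List.mem_cons_of_mem _ hq))]
    have hp : p.1 < 6 := h6 p List.mem_cons_self
    have e : ∑ k ∈ Finset.range 6, ((if p.1 = k then p.2 else 0) + (l.map fun q => if q.1 = k then q.2 else 0).sum) * d k
        = (∑ k ∈ Finset.range 6, (if p.1 = k then p.2 else 0) * d k) +
          ∑ k ∈ Finset.range 6, (l.map fun q => if q.1 = k then q.2 else 0).sum * d k := by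
      rw [← Finset.sum_add_distrib]; exact Finset.sum_congr rfl fun k _ => by ring
    rw [e]
    congr 1
    rw [Finset.sum_eq_single p.1 (fun k _ hk => by rw [if_neg (Ne.symm hk), zero_mul])
      (fun hn => absurd (Finset.mem_range.2 hp) hn), if_pos rfl]

/-- The linear part as a dot product with the total coefficients, when all indices are `< 6`. [folklore] -/
theorem lam_eq_sum_coefAt (R : RRow) (h6 : ∀ p ∈ R.coef, p.1 < 6) (d : ℕ → ℝ) :
    R.lam d = ∑ k ∈ Finset.range 6, R.coefAt k * d k := sum_map_eq_sum_range R.coef h6 d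

end RRow

namespace RTerm

/-- [folklore] -/
theorem sum_q_add (l : List RRow) (c d : ℕ → ℝ) :
    (l.map fun R => R.κ * R.ell (fun k => c k + d k) ^ 2).sum = (l.map fun R => R.κ * R.ell c ^ 2).sum +
      (l.map fun R => 2 * R.κ * R.ell c * R.lam d).sum + (l.map fun R => R.κ * R.lam d ^ 2).sum := by
  induction l with
  | nil => simp
  | cons R l ih => simp only [List.map_cons, List.sum_cons]; rw [ih, RRow.ell_add]; ring

/-- **Exact second-order expansion of the quadratic form**: `q(c + d) = q(c) + ∇q(c)·d + C(d)`. [folklore] -/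
theorem q_add (T : RTerm) (c d : ℕ → ℝ) :
    T.q (fun k => c k + d k) = T.q c + T.gradDot c d + T.curv d := sum_q_add T.rows c d

/-- [folklore] -/
theorem sum_gradDot_mid (l : List RRow) (c d : ℕ → ℝ) :
    (l.map fun R => 2 * R.κ * R.ell (fun k => c k + (1 / 2) * d k) * R.lam d).sum =
      (l.map fun R => 2 * R.κ * R.ell c * R.lam d).sum + (l.map fun R => R.κ * R.lam d ^ 2).sum := by
  induction l with
  | nil => simp
  | cons R l ih => simp only [List.map_cons, List.sum_cons]; rw [ih, RRow.ell_add, RRow.lam_smul]; ring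

/-- **Midpoint form**: `q(c + d) − q(c) = ∇q(c + d/2)·d`. [folklore] -/
theorem q_add_sub_eq_gradDot_mid (T : RTerm) (c d : ℕ → ℝ) :
    T.q (fun k => c k + d k) - T.q c = T.gradDot (fun k => c k + (1 / 2) * d k) d := by
  rw [q_add]; unfold gradDot curv; rw [sum_gradDot_mid]; ring

/-- [folklore] -/
theorem sum_gradDot_eq (l : List RRow) (h6 : ∀ R ∈ l, ∀ p ∈ R.coef, p.1 < 6) (x d : ℕ → ℝ) :
    (l.map fun R => 2 * R.κ * R.ell x * R.lam d).sum =
      ∑ k ∈ Finset.range 6, (l.map fun R => 2 * R.κ * R.coefAt k * R.ell x).sum * d k := by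
  induction l with
  | nil => simp
  | cons R l ih =>
    simp only [List.map_cons, List.sum_cons]
    rw [ih (fun R' hR' => h6 R' (List.mem_cons_of_mem _ hR')),
      RRow.lam_eq_sum_coefAt R (h6 R List.mem_cons_self), Finset.mul_sum, ← Finset.sum_add_distrib]
    exact Finset.sum_congr rfl fun k _ => by ring

/-- `∇q(x)·d` as a coordinate sum, when all indices are `< 6`. [folklore] -/
theorem gradDot_eq_sum_dq (T : RTerm) (h6 : ∀ R ∈ T.rows, ∀ p ∈ R.coef, p.1 < 6) (x d : ℕ → ℝ) :
    T.gradDot x d = ∑ k ∈ Finset.range 6, T.dq x k * d k := sum_gradDot_eq T.rows h6 x d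

/-- [folklore] -/
theorem sum_curv_eq (l : List RRow) (h6 : ∀ R ∈ l, ∀ p ∈ R.coef, p.1 < 6) (d : ℕ → ℝ) :
    (l.map fun R => R.κ * R.lam d ^ 2).sum =
      (1 / 2) * ∑ k ∈ Finset.range 6, ∑ k' ∈ Finset.range 6,
        (l.map fun R => 2 * R.κ * R.coefAt k * R.coefAt k').sum * d k * d k' := by
  induction l with
  | nil => simp
  | cons R l ih =>
    simp only [List.map_cons, List.sum_cons]
    rw [ih (fun R' hR' => h6 R' (List.mem_cons_of_mem _ hR')), RRow.lam_eq_sum_coefAt R (h6 R List.mem_cons_self)]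
    have e : (∑ k ∈ Finset.range 6, R.coefAt k * d k) ^ 2 =
        ∑ k ∈ Finset.range 6, ∑ k' ∈ Finset.range 6, R.coefAt k * R.coefAt k' * d k * d k' := by
      rw [sq, Finset.sum_mul_sum]
      exact Finset.sum_congr rfl fun k _ => Finset.sum_congr rfl fun k' _ => by ring
    rw [e, Finset.mul_sum, Finset.mul_sum, Finset.mul_sum, ← Finset.sum_add_distrib]
    refine Finset.sum_congr rfl fun k _ => ?_
    rw [Finset.mul_sum, Finset.mul_sum, Finset.mul_sum, ← Finset.sum_add_distrib]
    exact Finset.sum_congr rfl fun k' _ => by ring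

/-- `C(d) = ½ Σ_{k,l} ∂²_{kl}q d_k d_l`, when all indices are `< 6`. [folklore] -/
theorem curv_eq_sum_hq (T : RTerm) (h6 : ∀ R ∈ T.rows, ∀ p ∈ R.coef, p.1 < 6) (d : ℕ → ℝ) :
    T.curv d = (1 / 2) * ∑ k ∈ Finset.range 6, ∑ k' ∈ Finset.range 6, T.hq k k' * d k * d k' :=
  sum_curv_eq T.rows h6 d

/-- [folklore] -/
theorem sum_curv_nonneg (l : List RRow) (hκ : ∀ R ∈ l, 0 ≤ R.κ) (d : ℕ → ℝ) :
    0 ≤ (l.map fun R => R.κ * R.lam d ^ 2).sum := by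
  induction l with
  | nil => simp
  | cons R l ih =>
    simp only [List.map_cons, List.sum_cons]
    exact add_nonneg (mul_nonneg (hκ R List.mem_cons_self) (sq_nonneg _))
      (ih fun R' h => hκ R' (List.mem_cons_of_mem _ h))

/-- The curvature is non-negative when the weights are. [folklore] -/
theorem curv_nonneg (T : RTerm) (hκ : ∀ R ∈ T.rows, 0 ≤ R.κ) (d : ℕ → ℝ) : 0 ≤ T.curv d := sum_curv_nonneg T.rows hκ d

/-- [folklore] -/
theorem sum_q_nonneg (l : List RRow) (hκ : ∀ R ∈ l, 0 ≤ R.κ) (t : ℕ → ℝ) :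
    0 ≤ (l.map fun R => R.κ * R.ell t ^ 2).sum := by
  induction l with
  | nil => simp
  | cons R l ih =>
    simp only [List.map_cons, List.sum_cons]
    exact add_nonneg (mul_nonneg (hκ R List.mem_cons_self) (sq_nonneg _))
      (ih fun R' h => hκ R' (List.mem_cons_of_mem _ h))

/-- The quadratic form is non-negative when the weights are. [folklore] -/
theorem q_nonneg (T : RTerm) (hκ : ∀ R ∈ T.rows, 0 ≤ R.κ) (t : ℕ → ℝ) : 0 ≤ T.q t := sum_q_nonneg T.rows hκ t

end RTerm

/-! ### Row-level inclusion theorems -/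

section Rows

variable {B : CBox} {c e : ℕ → ℝ}

/-- The centre fold encloses the real centre sum. [folklore] -/
theorem foldr_centre_mem (hB : BoxEncl B c e) : ∀ {lc : List (ℕ × FI)} {lr : List (ℕ × ℝ)},
    List.Forall₂ (fun c' r => c'.1 = r.1 ∧ FI.mem r.2 c'.2) lc lr → ∀ {x : ℝ} {X : FI}, FI.mem x X →
    FI.mem ((lr.map fun p => p.2 * c p.1).sum + x)
      (lc.foldr (fun p acc => FI.add (FI.mul p.2 (getFI B.centre p.1)) acc) X)
  | _, _, List.Forall₂.nil, x, X, hx => by simpa using hx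
  | _, _, List.Forall₂.cons (a := p) (b := r) hpr hrest, x, X, hx => by
      simp only [List.foldr_cons, List.map_cons, List.sum_cons]
      rw [add_assoc]
      refine FI.mem_add ?_ (foldr_centre_mem hB hrest hx)
      rw [← hpr.1]
      exact FI.mem_mul hpr.2 (hB.1 p.1)

/-- `rowCentre` encloses `ℓ(c)`. [folklore] -/
theorem rowCentre_mem (hB : BoxEncl B c e) {C : CRow} {R : RRow} (hR : RowEncl C R) :
    FI.mem (R.ell c) (rowCentre B C) :=
  foldr_centre_mem hB hR.2.1 hR.2.2

/-- One entry of the deviation bound: `|α| e_k · SC ≤ ⌊absHi · half_k / SC⌋ + 1`. [folklore] -/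
theorem abs_mul_e_le (hB : BoxEncl B c e) {α : ℝ} {A : FI} (hα : FI.mem α A) (k : ℕ) :
    |α| * e k * SC ≤ (((FI.absHi A).toNat * B.half.getD k 0 / SC + 1 : ℕ) : ℝ) := by
  obtain ⟨he0, he⟩ := hB.2 k
  have hS := SC_pos
  have ha : |α| * SC ≤ (FI.absHi A : ℝ) := FI.abs_le_absHi hα
  have ha0 : (0 : ℤ) ≤ FI.absHi A := by unfold FI.absHi; positivity
  set N : ℕ := (FI.absHi A).toNat with hN
  have hcast : (N : ℝ) = ((FI.absHi A : ℤ) : ℝ) := by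
    rw [hN]; exact_mod_cast Int.toNat_of_nonneg ha0
  set Hh : ℕ := B.half.getD k 0 with hHh
  have hprod : |α| * e k * SC * SC ≤ (N : ℝ) * Hh := by
    rw [hcast]
    calc |α| * e k * SC * SC = (|α| * SC) * (e k * SC) := by ring
      _ ≤ (FI.absHi A : ℝ) * Hh := mul_le_mul ha he (by positivity) (by positivity)
  have hdiv : ((N * Hh : ℕ) : ℝ) < ((N * Hh / SC + 1 : ℕ) : ℝ) * SC := by
    have h := Nat.lt_div_mul_add (a := N * Hh) (b := SC) (by norm_num [SC])
    have h' : N * Hh < (N * Hh / SC + 1) * SC := by rw [add_mul, one_mul]; exact h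
    exact_mod_cast h'
  push_cast at hprod hdiv ⊢
  by_contra hcon
  push Not at hcon
  nlinarith [hcon, hprod, hdiv]

/-- The deviation fold dominates the real deviation (scaled). [folklore] -/
theorem foldr_dev_le (hB : BoxEncl B c e) : ∀ {lc : List (ℕ × FI)} {lr : List (ℕ × ℝ)},
    List.Forall₂ (fun c' r => c'.1 = r.1 ∧ FI.mem r.2 c'.2) lc lr →
    (lr.map fun p => |p.2| * e p.1).sum * SC ≤
      ((lc.foldr (fun p acc => (FI.absHi p.2).toNat * B.half.getD p.1 0 / SC + 1 + acc) 0 : ℕ) : ℝ)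
  | _, _, List.Forall₂.nil => by simp
  | _, _, List.Forall₂.cons (a := p) (b := r) hpr hrest => by
      simp only [List.foldr_cons, List.map_cons, List.sum_cons]
      push_cast
      rw [add_mul]
      refine add_le_add ?_ (by exact_mod_cast foldr_dev_le hB hrest)
      have h := abs_mul_e_le hB hpr.2 p.1
      rw [← hpr.1]
      exact_mod_cast h

/-- `rowDev` dominates the deviation `Σ |α_k| e_k` (scaled). [folklore] -/
theorem dev_le_rowDev (hB : BoxEncl B c e) {C : CRow} {R : RRow} (hR : RowEncl C R) :
    R.dev e * SC ≤ (rowDev B C : ℝ) :=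
  foldr_dev_le hB hR.2.1

/-- `ℓ(t) − ℓ(c) = λ(t − c)`. [folklore] -/
theorem ell_sub (R : RRow) (t c' : ℕ → ℝ) : R.ell t - R.ell c' = R.lam (fun k => t k - c' k) := by
  have := R.ell_add c' (fun k => t k - c' k)
  simp only [add_sub_cancel] at this
  linarith

/-- `rowRange` encloses `ℓ(t)` for every `t` in the box. [folklore] -/
theorem rowRange_mem (hB : BoxEncl B c e) {C : CRow} {R : RRow} (hR : RowEncl C R) {t : ℕ → ℝ}
    (ht : InBox c e t) : FI.mem (R.ell t) (rowRange B C) := by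
  have hc := rowCentre_mem hB hR
  have hdev := dev_le_rowDev hB hR
  have hlam : |R.ell t - R.ell c| ≤ R.dev e := by rw [ell_sub]; exact R.abs_lam_le ht
  obtain ⟨h1, h2⟩ := hc
  have hab := abs_le.1 hlam
  simp only [rowRange, FI.mem, Int.cast_sub, Int.cast_add, Int.cast_natCast]
  have hS := SC_pos
  constructor <;> nlinarith [hab.1, hab.2, mul_le_mul_of_nonneg_right hlam hS.le]

end Rows

end Far

end Summit.AtomisticToContinuum.Crystallization.Theorems.NashClassCertificatesNashNearField

end
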